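import Summits.CriticalPhenomena.CardyFormulaZ2.Theorems.CardySelfRefinementSymmetryUpgradeRZhouDefs
import Summits.CriticalPhenomena.CardyFormulaZ2.Theorems.CardyComplexConeSLESixFamiliesGiveCardy
import Summits.CriticalPhenomena.CardyFormulaZ2.Theorems.CardyComplexConeParafermionToSLESixFamiliesIicRectilinear
import HarnessLib

/-!
# Stub S5 `stub_allDomainsOfZhouClass` of line `zhou-rotation-split-audit` (crux `SymmetryUpgradeR`, stmt-CriticalPhenomena-17239): audit and the reduction to two literature-sized pieces

Route `CardySelfRefinement` (sub-problem `CriticalPhenomena/CardyFormulaZ2`), crux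
`Summit.CriticalPhenomena.CardyFormulaZ2.Theses.CardySelfRefinement.SymmetryUpgradeR`, line
`zhou-rotation-split-audit` (skeleton `Cruxes/SymmetryUpgradeR/Lines/zhou_rotation_split_audit.lean`,
vocabulary `Theorems/CardySelfRefinementSymmetryUpgradeRZhouDefs.lean`).  The registered stub reads

  `SLESixOnZhouClass → Literature.Probability.Percolation.SLE6LimitZ2AllDiscretisations`

(ONE SLE₆-convergent admissible family on every convex-corner-marked rectilinear Dobrushin polygon ⇒
Smirnov's Conjecture 4 at `q = 1` for EVERY Dobrushin domain along EVERY admissible family).  This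
file does NOT prove it.  It records, sorry-free and without defining any proposition:

* **Audit (no degeneracy).**  Both sides are stated with the same `ConvergesInLawToSLE 6 D` along
  `𝓝[>] 0` over the same `bondInterfaceIn`; the conclusion is the OPEN conjecture (no `_holds`, no
  refutation); the hypothesis is a genuine instance of it: the Zhou class is inhabited
  (`zhouClass_nonempty` of the skeleton) and EVERY Dobrushin domain carries an admissible family
  (`DiscretisationFamilyExists_proof`, stmt-9644), so neither ex falso nor a vacuous `∀` is available.
  `ZdDiscretisationFamily D E` does NOT pin `E`: the data `E δ = ⟨D, δ, arcA_δ, arcB_δ⟩` have free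
  continuous arcs, whence discrete arcs / `A`–`B` edges displaced by `o(1)` near the marks; so the
  `∃ E` of the hypothesis is strictly weaker than the `∀ E` of the conclusion already on the Zhou
  class, and step (i) of the card (family insensitivity) is not empty.
* **§1 The collar-touch sandwich, per rectangle** (`hasCrossingLimit_of_sle6Collars`): for a FIXED
  conformal rectangle `R`, if for every `ε > 0` there are `ε`-close upper/lower exterior-collared
  comparison rectangles (`UpperCollarGeom`, `LowerCollarGeom` of crux 9654's line
  `collar-touch-sandwich`) each of whose Dobrushin domains carries SOME admissible family along which
  the bond-`ℤ²` interface converges in law to SLE₆, then Cardy's formula holds at `R`.  This is the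
  proof of `cardy_of_statements` (`Theorems/CardyComplexConeSLESixFamiliesGiveCardy.lean`) re-run with
  its five PROVED statements A `stub_upperFence`, B `stub_lowerRun`, C `stub_touchLimsup`,
  D `stub_sleSideTouch`, G `stub_modulusContinuity`, the designer domains and their families being
  now INPUTS (there: statements E, F at smooth marks; here: whatever class one has SLE₆ on).
* **§2 SLE₆ on the Zhou class gives Cardy, given Zhou-class collars** (`rectilinearCardy_of_zhouClass`,
  `cardyFormulaZ2_of_zhouClass`): if every RECTILINEAR conformal rectangle admits `ε`-close collared
  comparison rectangles whose Dobrushin domains are corner-marked rectilinear polygons (a deterministic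
  planar-geometry construction, the Zhou-class twin of statement E `CollarDomains`; spelled out as a
  HYPOTHESIS), then `SLESixOnZhouClass → RectilinearCardy`, hence `→ CardyFormulaZ2` by the PROVED
  Bollobás–Riordan sandwich `RectilinearSuffices_proof`.
* **§3 The reduction** (`allDomainsOfZhouClass_of`, registered): S5 follows from that geometric
  piece and from the Camia–Newman transfer on `ℤ²` (`CardyFormulaZ2` ⇒ identification of every
  subsequential interface law as chordal SLE₆, for every Dobrushin domain and every admissible
  family — verbatim PIECE 2 of the sibling reduction `allDomainsOfRectilinear_of`, crux 11389, up to
  bundling), glued through Aizenman–Burchard tightness for arbitrary admissible families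
  (`isTightAlongMesh_bondInterfaceIn`, landed), measurability (`measurable_bondInterfaceIn`) and the
  tree's Prokhorov + uniqueness criterion (`convergesInLawToSLE_of_isTightAlongMesh'`).  Both pieces
  appear only as HYPOTHESES, spelled out in full; neither is a named fact of the tree.

Sources: F. Camia, C. M. Newman, Probab. Theory Relat. Fields 139 (2007), Thms 2–5, §§5–7;
W. Werner, *Lectures on two-dimensional critical percolation* (2007), Lecture 3; B. Bollobás,
O. Riordan, *Percolation* (CUP 2006), Ch. 7; M. Aizenman, A. Burchard, Duke Math. J. 99 (1999).
-/

noncomputable section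

open Set Filter Topology Metric MeasureTheory
open scoped NNReal
open UpperHalfPlane (upperHalfPlaneSet)
open Literature.Probability Literature.Probability.RandomPlanarGeometry
  Literature.Probability.LatticeModels Literature.Probability.Percolation
open Summit.CriticalPhenomena.CardyFormulaZ2.Cruxes.SLESixFamiliesGiveCardy.CollarTouchSandwich
  (UpperCollarGeom LowerCollarGeom stub_upperFence stub_lowerRun stub_touchLimsup stub_sleSideTouch
    stub_modulusContinuity rotateTwo crossRatio_rotateTwo boundary_rotateTwo)
open Summit.CriticalPhenomena.CardyFormulaZ2.Theses.CardyBoundaryCoulombGas (RectilinearCardy)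

namespace Summit.CriticalPhenomena.CardyFormulaZ2.Theorems.SymmetryUpgradeR.ZhouRotationSplitAudit

/-! ## §1 The collar-touch sandwich for one conformal rectangle, designer domains and families as inputs -/

/-- **Cardy's formula at `R` from SLE₆ along SOME admissible family of `ε`-close collared comparison
domains** (the proof of `cardy_of_statements`, crux 9654, with statements A, B, C, D, G supplied by
their landed proofs and statements E, F replaced by the hypothesis).  Given a uniformizing datum
`(φ, x)` of `R` and `e > 0`, put `ε = e/8`, take a modulus `θ` of uniform continuity of `F` on `[0,1]`,
closeness tolerances `ε₁, ε₂` for `R` and `rotateTwo R` (G), the two collared rectangles at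
`min ε₁ ε₂` with their SLE₆-convergent families (hypothesis), touch radii `η₁, η₂` (D), the eventual
inclusions (A, B), the portmanteau bounds (C), and conclude `|P[C_δ] - F(η_R)| < e` eventually. -/
theorem hasCrossingLimit_of_sle6Collars (R : ConformalRectangle)
    (hcol : ∀ ε : ℝ, 0 < ε →
      (∃ (Q : ConformalRectangle) (c : ℝ), UpperCollarGeom R (Q.chord 0 1 (by decide)) (Q.arc 2) ∧
        (∃ Λ : ℝ → DiscreteDobrushin, ZdDiscretisationFamily (Q.chord 0 1 (by decide)) Λ ∧
          ConvergesInLawToSLE 6 (Q.chord 0 1 (by decide)) (Ωδ := fun _ => BondConfig (Site 2))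
            (fun δ => Literature.Probability.Percolation.bondInterfaceIn (Q.chord 0 1 (by decide)) (Λ δ))
            (fun _ => bondPercolation (zdGraph 2) Percolation.half)) ∧
        (∀ s : ℝ, dist (Q.boundary s) (R.boundary (s + c)) ≤ ε) ∧
        ∀ i : Fin 4, |Q.mark i + c - R.mark i| ≤ ε) ∧
      (∃ (Q : ConformalRectangle) (c : ℝ), LowerCollarGeom R (Q.chord 0 3 (by decide)) (Q.arc 1) ∧
        (∃ Λ : ℝ → DiscreteDobrushin, ZdDiscretisationFamily (Q.chord 0 3 (by decide)) Λ ∧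
          ConvergesInLawToSLE 6 (Q.chord 0 3 (by decide)) (Ωδ := fun _ => BondConfig (Site 2))
            (fun δ => Literature.Probability.Percolation.bondInterfaceIn (Q.chord 0 3 (by decide)) (Λ δ))
            (fun _ => bondPercolation (zdGraph 2) Percolation.half)) ∧
        (∀ s : ℝ, dist (Q.boundary s) (R.boundary (s + c)) ≤ ε) ∧
        |Q.mark 0 + c - R.mark 2| ≤ ε ∧ |Q.mark 1 + c - R.mark 3| ≤ ε ∧
        |Q.mark 2 + c - (R.mark 0 + 1)| ≤ ε ∧ |Q.mark 3 + c - (R.mark 1 + 1)| ≤ ε)) :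
    R.HasCrossingLimit (bondDomainCrossingProb R) RandomPlanarGeometry.cardyFunction := by
  -- adapted from `CollarTouchSandwich.cardy_of_statements` (Theorems/CardyComplexConeSLESixFamiliesGiveCardy.lean)
  intro φ x hux
  rw [Metric.tendsto_nhds]
  intro e he
  -- tolerances
  set ε : ℝ := e / 8 with hε8
  have hε : 0 < ε := by positivity
  have hηI : crossRatio x ∈ Icc (0 : ℝ) 1 :=
    Ioo_subset_Icc_self (ConformalRectangle.crossRatio_mem_Ioo_of_isUniformizing hux)
  have hUC : UniformContinuousOn RandomPlanarGeometry.cardyFunction (Icc (0 : ℝ) 1) :=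
    isCompact_Icc.uniformContinuousOn_of_continuous continuousOn_cardyFunction_holds
  obtain ⟨θ, hθ, hθF⟩ := Metric.uniformContinuousOn_iff.1 hUC ε hε
  -- STATEMENT G (proved): closeness tolerances for `R` and for `rotateTwo R`
  obtain ⟨φ'', x'', hux''⟩ := MarkedDomain.exists_isUniformizing_holds (rotateTwo R)
  have hrot : crossRatio x'' = crossRatio x := crossRatio_rotateTwo hux hux''
  obtain ⟨ε₁, hε₁, hM₁⟩ := stub_modulusContinuity R φ x hux (θ / 2) (half_pos hθ)
  obtain ⟨ε₂, hε₂, hM₂⟩ := stub_modulusContinuity (rotateTwo R) φ'' x'' hux'' (θ / 2) (half_pos hθ)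
  -- HYPOTHESIS: the two collared comparison rectangles with their SLE₆-convergent families
  obtain ⟨⟨Q₁, c₁, hgeo₁, ⟨Λ₁, hΛ₁, Γ₁, hΓ₁, hmeas₁, hlaw₁⟩, hcl₁, hmk₁⟩,
      ⟨Q₂, c₂, hgeo₂, ⟨Λ₂, hΛ₂, Γ₂, hΓ₂, hmeas₂, hlaw₂⟩, hcl₂, hk₀, hk₁, hk₂, hk₃⟩⟩ :=
    hcol (min ε₁ ε₂) (lt_min hε₁ hε₂)
  -- moduli: every datum of `Q₁`, `Q₂` has cross-ratio within `θ/2` of `crossRatio x`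
  have hmod₁ : ∀ (φ' : ConformalEquiv upperHalfPlaneSet Q₁.carrier) (x' : Fin 4 → ℝ),
      Q₁.IsUniformizing φ' x' → |crossRatio x' - crossRatio x| ≤ θ / 2 :=
    hM₁ Q₁ c₁ (fun s ↦ (hcl₁ s).trans (min_le_left _ _)) (fun i ↦ (hmk₁ i).trans (min_le_left _ _))
  have hmod₂ : ∀ (φ' : ConformalEquiv upperHalfPlaneSet Q₂.carrier) (x' : Fin 4 → ℝ),
      Q₂.IsUniformizing φ' x' → |crossRatio x' - crossRatio x| ≤ θ / 2 := by
    intro φ' x' h'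
    rw [← hrot]
    refine hM₂ Q₂ (c₂ - R.mark 2) (fun s ↦ ?_) (fun i ↦ ?_) φ' x' h'
    · rw [boundary_rotateTwo, show s + (c₂ - R.mark 2) + R.mark 2 = s + c₂ by ring]
      exact (hcl₂ s).trans (min_le_right _ _)
    · fin_cases i
      · show |Q₂.mark 0 + (c₂ - R.mark 2) - 0| ≤ ε₂
        rw [show Q₂.mark 0 + (c₂ - R.mark 2) - 0 = Q₂.mark 0 + c₂ - R.mark 2 by ring]
        exact hk₀.trans (min_le_right _ _)
      · show |Q₂.mark 1 + (c₂ - R.mark 2) - (R.mark 3 - R.mark 2)| ≤ ε₂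
        rw [show Q₂.mark 1 + (c₂ - R.mark 2) - (R.mark 3 - R.mark 2) = Q₂.mark 1 + c₂ - R.mark 3 by ring]
        exact hk₁.trans (min_le_right _ _)
      · show |Q₂.mark 2 + (c₂ - R.mark 2) - (R.mark 0 + 1 - R.mark 2)| ≤ ε₂
        rw [show Q₂.mark 2 + (c₂ - R.mark 2) - (R.mark 0 + 1 - R.mark 2) =
          Q₂.mark 2 + c₂ - (R.mark 0 + 1) by ring]
        exact hk₂.trans (min_le_right _ _)
      · show |Q₂.mark 3 + (c₂ - R.mark 2) - (R.mark 1 + 1 - R.mark 2)| ≤ ε₂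
        rw [show Q₂.mark 3 + (c₂ - R.mark 2) - (R.mark 1 + 1 - R.mark 2) =
          Q₂.mark 3 + c₂ - (R.mark 1 + 1) by ring]
        exact hk₃.trans (min_le_right _ _)
  -- the interface maps are the fact-free `Interface.bondInterfaceIn` (definitionally)
  have hmeas₁' : ∀ᶠ δ : ℝ in 𝓝[>] 0,
      AEMeasurable (fun ω => Interface.bondInterfaceIn (Q₁.chord 0 1 (by decide)) (Λ₁ δ) ω)
        (bondPercolation (zdGraph 2) Percolation.half) := hmeas₁
  have hlaw₁' : TendstoLaw (Ωδ := fun _ => BondConfig (Site 2))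
      (fun δ ω => Interface.bondInterfaceIn (Q₁.chord 0 1 (by decide)) (Λ₁ δ) ω)
      (fun _ => bondPercolation (zdGraph 2) Percolation.half) Γ₁ Process.preWienerMeasure := hlaw₁
  have hmeas₂' : ∀ᶠ δ : ℝ in 𝓝[>] 0,
      AEMeasurable (fun ω => Interface.bondInterfaceIn (Q₂.chord 0 3 (by decide)) (Λ₂ δ) ω)
        (bondPercolation (zdGraph 2) Percolation.half) := hmeas₂
  have hlaw₂' : TendstoLaw (Ωδ := fun _ => BondConfig (Site 2))
      (fun δ ω => Interface.bondInterfaceIn (Q₂.chord 0 3 (by decide)) (Λ₂ δ) ω)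
      (fun _ => bondPercolation (zdGraph 2) Percolation.half) Γ₂ Process.preWienerMeasure := hlaw₂
  -- uniformizing data of `Q₁`, `Q₂` and the SLE₆ touch limits (STATEMENT D, proved)
  obtain ⟨φ₁, x₁, hux₁⟩ := MarkedDomain.exists_isUniformizing_holds Q₁
  obtain ⟨φ₂, x₂, hux₂⟩ := MarkedDomain.exists_isUniformizing_holds Q₂
  have ht₁ := (stub_sleSideTouch Q₁ φ₁ x₁ hux₁).1 Γ₁ hΓ₁
  have ht₂ := (stub_sleSideTouch Q₂ φ₂ x₂ hux₂).2 Γ₂ hΓ₂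
  obtain ⟨η₁, hη₁v, hη₁⟩ := ((Metric.tendsto_nhds.1 ht₁ ε hε).and self_mem_nhdsWithin).exists
  obtain ⟨η₂, hη₂v, hη₂⟩ := ((Metric.tendsto_nhds.1 ht₂ ε hε).and self_mem_nhdsWithin).exists
  replace hη₁ : 0 < η₁ := hη₁
  replace hη₂ : 0 < η₂ := hη₂
  -- moduli: `|F(η_{Qᵢ}) - F(η_R)| < ε`
  have hx₁I : crossRatio x₁ ∈ Icc (0 : ℝ) 1 :=
    Ioo_subset_Icc_self (ConformalRectangle.crossRatio_mem_Ioo_of_isUniformizing hux₁)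
  have hx₂I : crossRatio x₂ ∈ Icc (0 : ℝ) 1 :=
    Ioo_subset_Icc_self (ConformalRectangle.crossRatio_mem_Ioo_of_isUniformizing hux₂)
  have hcr₁ : |crossRatio x₁ - crossRatio x| ≤ θ / 2 := hmod₁ φ₁ x₁ hux₁
  have hcr₂ : |crossRatio x₂ - crossRatio x| ≤ θ / 2 := hmod₂ φ₂ x₂ hux₂
  have hF₁ : dist (RandomPlanarGeometry.cardyFunction (crossRatio x₁))
      (RandomPlanarGeometry.cardyFunction (crossRatio x)) < ε :=
    hθF _ hx₁I _ hηI (by rw [Real.dist_eq]; linarith)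
  have hF₂ : dist (RandomPlanarGeometry.cardyFunction (crossRatio x₂))
      (RandomPlanarGeometry.cardyFunction (crossRatio x)) < ε :=
    hθF _ hx₂I _ hηI (by rw [Real.dist_eq]; linarith)
  -- STATEMENTS A, B (proved): the deterministic inclusions at `η₁`, `η₂`
  have hinc₁ := stub_upperFence R _ _ hgeo₁ Λ₁ hΛ₁ η₁ hη₁
  have hinc₂ := stub_lowerRun R _ _ hgeo₂ Λ₂ hΛ₂ η₂ hη₂
  -- the closed touch sets
  set K₁ : Set ℂ := cthickening η₁ (Q₁.arc 2) with hK₁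
  set K₂ : Set ℂ := cthickening η₂ (Q₂.arc 1) with hK₂
  have hK₁c : IsClosed K₁ := isClosed_cthickening
  have hK₂c : IsClosed K₂ := isClosed_cthickening
  -- eventual containments in the range events of the oriented interface classes
  have hev₁ : ∀ᶠ δ : ℝ in 𝓝[>] 0, discreteCrossing R.carrier δ (R.arc 0) (R.arc 2) ⊆
      {ω | ((Interface.bondInterfaceIn (Q₁.chord 0 1 (by decide)) (Λ₁ δ) ω).range ∩ K₁).Nonempty} := by
    filter_upwards [hinc₁] with δ hδ ω hω
    have h := hδ hω
    simp only [mem_setOf_eq] at h ⊢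
    rwa [Interface.range_bondInterfaceIn]
  have hev₂ : ∀ᶠ δ : ℝ in 𝓝[>] 0, (discreteCrossing R.carrier δ (R.arc 0) (R.arc 2))ᶜ ⊆
      {ω | ((Interface.bondInterfaceIn (Q₂.chord 0 3 (by decide)) (Λ₂ δ) ω).range ∩ K₂).Nonempty} := by
    filter_upwards [hinc₂] with δ hδ ω hω
    simp only [mem_setOf_eq]
    rw [Interface.range_bondInterfaceIn]
    by_contra hne
    rw [not_nonempty_iff_eq_empty] at hne
    exact hω (hδ (show ω ∈ {ω | Disjoint (range (medialExplorationCurve (Λ₂ δ) ω)) K₂} from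
      disjoint_iff_inter_eq_empty.2 hne))
  -- STATEMENT C (proved): portmanteau
  have hpm₁ := stub_touchLimsup _ Γ₁ hΓ₁.aemeasurable hmeas₁' hlaw₁' K₁ hK₁c _ hev₁ ε hε
  have hpm₂ := stub_touchLimsup _ Γ₂ hΓ₂.aemeasurable hmeas₂' hlaw₂' K₂ hK₂c _ hev₂ ε hε
  -- assemble
  rw [Real.dist_eq, abs_sub_lt_iff] at hη₁v hη₂v hF₁ hF₂
  filter_upwards [hpm₁, hpm₂] with δ h₁ h₂
  set C : Set (BondConfig (Site 2)) := discreteCrossing R.carrier δ (R.arc 0) (R.arc 2) with hC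
  have hsum : 1 ≤ (bondPercolation (zdGraph 2) Percolation.half).real C +
      (bondPercolation (zdGraph 2) Percolation.half).real Cᶜ := by
    calc (1 : ℝ) = (bondPercolation (zdGraph 2) Percolation.half).real univ := probReal_univ.symm
      _ = (bondPercolation (zdGraph 2) Percolation.half).real (C ∪ Cᶜ) := by rw [union_compl_self]
      _ ≤ _ := measureReal_union_le _ _
  have hp : bondDomainCrossingProb R δ = (bondPercolation (zdGraph 2) Percolation.half).real C := rfl
  rw [hp, Real.dist_eq, abs_sub_lt_iff]
  constructor <;> linarith

/-! ## §2 SLE₆ on the Zhou class gives Cardy's formula, given Zhou-class collars (a hypothesis) -/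

/-- **`SLESixOnZhouClass → RectilinearCardy`, given Zhou-class collars.**  HYPOTHESIS (deterministic
planar geometry, UNPROVED; the corner-marked rectilinear twin of statement E `CollarDomains` of crux
9654, which builds smooth-marked tube collars): every conformal rectangle whose frontier lies in
finitely many axis-parallel segments admits, for every `ε > 0`, an upper and a lower exterior-collared
comparison rectangle (`UpperCollarGeom`, `LowerCollarGeom`), boundary loop and marks `ε`-close after a
shift, whose Dobrushin domains `Q.chord 0 1`, `Q.chord 0 3` are rectilinear polygons with both marks at
convex right-angle corners (`IsRectilinear`, `IsCornerMark`: rectilinear collars behind shortened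
sub-arcs, marks at collar corners).  On such domains `SLESixOnZhouClass` hands the SLE₆-convergent
admissible family to the per-rectangle sandwich `hasCrossingLimit_of_sle6Collars`. -/
theorem rectilinearCardy_of_zhouClass
    (hG : ∀ R : ConformalRectangle, (∃ S : Finset (ℂ × ℂ), (∀ p ∈ S, p.1.re = p.2.re ∨ p.1.im = p.2.im) ∧
        frontier R.carrier ⊆ ⋃ p ∈ S, segment ℝ p.1 p.2) → ∀ ε : ℝ, 0 < ε →
      (∃ (Q : ConformalRectangle) (c : ℝ), UpperCollarGeom R (Q.chord 0 1 (by decide)) (Q.arc 2) ∧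
          IsRectilinear (Q.chord 0 1 (by decide)) ∧ IsCornerMark (Q.chord 0 1 (by decide)) 0 ∧
          IsCornerMark (Q.chord 0 1 (by decide)) 1 ∧
          (∀ s : ℝ, dist (Q.boundary s) (R.boundary (s + c)) ≤ ε) ∧
          ∀ i : Fin 4, |Q.mark i + c - R.mark i| ≤ ε) ∧
      (∃ (Q : ConformalRectangle) (c : ℝ), LowerCollarGeom R (Q.chord 0 3 (by decide)) (Q.arc 1) ∧
          IsRectilinear (Q.chord 0 3 (by decide)) ∧ IsCornerMark (Q.chord 0 3 (by decide)) 0 ∧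
          IsCornerMark (Q.chord 0 3 (by decide)) 1 ∧
          (∀ s : ℝ, dist (Q.boundary s) (R.boundary (s + c)) ≤ ε) ∧
          |Q.mark 0 + c - R.mark 2| ≤ ε ∧ |Q.mark 1 + c - R.mark 3| ≤ ε ∧
          |Q.mark 2 + c - (R.mark 0 + 1)| ≤ ε ∧ |Q.mark 3 + c - (R.mark 1 + 1)| ≤ ε))
    (hZ : SLESixOnZhouClass) : RectilinearCardy := by
  intro R hR
  refine hasCrossingLimit_of_sle6Collars R fun ε hε => ?_
  obtain ⟨⟨Q₁, c₁, hgeo₁, hr₁, hm₁₀, hm₁₁, hcl₁, hmk₁⟩, ⟨Q₂, c₂, hgeo₂, hr₂, hm₂₀, hm₂₁, hcl₂, hk⟩⟩ :=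
    hG R hR ε hε
  exact ⟨⟨Q₁, c₁, hgeo₁, hZ _ hr₁ hm₁₀ hm₁₁, hcl₁, hmk₁⟩, ⟨Q₂, c₂, hgeo₂, hZ _ hr₂ hm₂₀ hm₂₁, hcl₂, hk⟩⟩

/-- **`SLESixOnZhouClass → CardyFormulaZ2`, given Zhou-class collars**: §2 followed by the PROVED
Bollobás–Riordan sandwich `RectilinearSuffices_proof` (Cardy on rectilinear conformal rectangles ⇒
Cardy's formula for bond-`ℤ²`). -/
theorem cardyFormulaZ2_of_zhouClass
    (hG : ∀ R : ConformalRectangle, (∃ S : Finset (ℂ × ℂ), (∀ p ∈ S, p.1.re = p.2.re ∨ p.1.im = p.2.im) ∧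
        frontier R.carrier ⊆ ⋃ p ∈ S, segment ℝ p.1 p.2) → ∀ ε : ℝ, 0 < ε →
      (∃ (Q : ConformalRectangle) (c : ℝ), UpperCollarGeom R (Q.chord 0 1 (by decide)) (Q.arc 2) ∧
          IsRectilinear (Q.chord 0 1 (by decide)) ∧ IsCornerMark (Q.chord 0 1 (by decide)) 0 ∧
          IsCornerMark (Q.chord 0 1 (by decide)) 1 ∧
          (∀ s : ℝ, dist (Q.boundary s) (R.boundary (s + c)) ≤ ε) ∧
          ∀ i : Fin 4, |Q.mark i + c - R.mark i| ≤ ε) ∧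
      (∃ (Q : ConformalRectangle) (c : ℝ), LowerCollarGeom R (Q.chord 0 3 (by decide)) (Q.arc 1) ∧
          IsRectilinear (Q.chord 0 3 (by decide)) ∧ IsCornerMark (Q.chord 0 3 (by decide)) 0 ∧
          IsCornerMark (Q.chord 0 3 (by decide)) 1 ∧
          (∀ s : ℝ, dist (Q.boundary s) (R.boundary (s + c)) ≤ ε) ∧
          |Q.mark 0 + c - R.mark 2| ≤ ε ∧ |Q.mark 1 + c - R.mark 3| ≤ ε ∧
          |Q.mark 2 + c - (R.mark 0 + 1)| ≤ ε ∧ |Q.mark 3 + c - (R.mark 1 + 1)| ≤ ε))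
    (hZ : SLESixOnZhouClass) : Literature.Probability.Percolation.CardyFormulaZ2 :=
  Summit.CriticalPhenomena.CardyFormulaZ2.Theorems.RectilinearSuffices_proof
    (rectilinearCardy_of_zhouClass hG hZ)

/-! ## §3 The reduction of S5 to its two missing pieces (typed as hypotheses) -/

/-- **One family: identification ⇒ SLE₆ convergence** along an admissible family of any Dobrushin
domain: Aizenman–Burchard tightness for arbitrary admissible data (`isTightAlongMesh_bondInterfaceIn`),
measurability (`measurable_bondInterfaceIn`) and the criterion `convergesInLawToSLE_of_isTightAlongMesh'`
(Prokhorov + uniqueness in law of SLE₆). -/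
theorem convergesInLawToSLE_of_ident (D : DobrushinDomain) (E : ℝ → DiscreteDobrushin)
    (hE : ZdDiscretisationFamily D E)
    (hI : ∀ μ : Measure (CurveClass ℂ), IsProbabilityMeasure μ →
      IsSubseqLimitLaw (Ωδ := fun _ => BondConfig (Site 2))
        (fun δ => Literature.Probability.Percolation.bondInterfaceIn D (E δ))
        (fun _ => bondPercolation (zdGraph 2) Percolation.half) μ → IsSLELaw 6 D μ) :
    ConvergesInLawToSLE 6 D (Ωδ := fun _ => BondConfig (Site 2))
      (fun δ => Literature.Probability.Percolation.bondInterfaceIn D (E δ))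
      (fun _ => bondPercolation (zdGraph 2) Percolation.half) :=
  convergesInLawToSLE_of_isTightAlongMesh'
    (Eventually.of_forall fun δ => (measurable_bondInterfaceIn D (E δ)).aemeasurable)
    (isTightAlongMesh_bondInterfaceIn D E hE.Ω_eq hE.δ_eq hE.eventually_isZdAdmissible) hI

/-- **S5 from its two missing pieces** (registered glue; kernel-checked composition).  Hypotheses,
both UNPROVED, neither a named fact of the tree:

* PIECE G (deterministic geometry) — Zhou-class collars for rectilinear conformal rectangles (the
  hypothesis of `rectilinearCardy_of_zhouClass`);
* PIECE CN — the Camia–Newman transfer on `ℤ²`: Cardy's formula for bond percolation in every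
  conformal rectangle ⇒ identification of every subsequential interface law as chordal SLE₆, for every
  Dobrushin domain and every admissible family (Camia–Newman 2007 Thms 2–4, §§5–7; Werner 2007
  Lecture 3 §§3.4–3.8; verbatim PIECE 2 of `IicTraceFluxPairing.allDomainsOfRectilinear_of` with the
  family fields bundled as `ZdDiscretisationFamily` and the interface spelled `bondInterfaceIn`).

Glue: PIECE G + `SLESixOnZhouClass` ⇒ (`cardyFormulaZ2_of_zhouClass`, through the PROVED
`RectilinearSuffices_proof`) `CardyFormulaZ2` ⇒ PIECE CN ⇒ (`convergesInLawToSLE_of_ident`: landed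
tightness + criterion) the conjecture for every domain and every family.  Step (i) of the card
(family insensitivity) is thereby routed through Cardy's formula, which is family-blind. -/
theorem allDomainsOfZhouClass_of :
    (∀ R : ConformalRectangle, (∃ S : Finset (ℂ × ℂ), (∀ p ∈ S, p.1.re = p.2.re ∨ p.1.im = p.2.im) ∧
        frontier R.carrier ⊆ ⋃ p ∈ S, segment ℝ p.1 p.2) → ∀ ε : ℝ, 0 < ε →
      (∃ (Q : ConformalRectangle) (c : ℝ), UpperCollarGeom R (Q.chord 0 1 (by decide)) (Q.arc 2) ∧
          IsRectilinear (Q.chord 0 1 (by decide)) ∧ IsCornerMark (Q.chord 0 1 (by decide)) 0 ∧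
          IsCornerMark (Q.chord 0 1 (by decide)) 1 ∧
          (∀ s : ℝ, dist (Q.boundary s) (R.boundary (s + c)) ≤ ε) ∧
          ∀ i : Fin 4, |Q.mark i + c - R.mark i| ≤ ε) ∧
      (∃ (Q : ConformalRectangle) (c : ℝ), LowerCollarGeom R (Q.chord 0 3 (by decide)) (Q.arc 1) ∧
          IsRectilinear (Q.chord 0 3 (by decide)) ∧ IsCornerMark (Q.chord 0 3 (by decide)) 0 ∧
          IsCornerMark (Q.chord 0 3 (by decide)) 1 ∧
          (∀ s : ℝ, dist (Q.boundary s) (R.boundary (s + c)) ≤ ε) ∧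
          |Q.mark 0 + c - R.mark 2| ≤ ε ∧ |Q.mark 1 + c - R.mark 3| ≤ ε ∧
          |Q.mark 2 + c - (R.mark 0 + 1)| ≤ ε ∧ |Q.mark 3 + c - (R.mark 1 + 1)| ≤ ε)) →
    (Literature.Probability.Percolation.CardyFormulaZ2 →
      ∀ (D : DobrushinDomain) (E : ℝ → DiscreteDobrushin), ZdDiscretisationFamily D E →
        ∀ μ : Measure (CurveClass ℂ), IsProbabilityMeasure μ →
          IsSubseqLimitLaw (Ωδ := fun _ => BondConfig (Site 2))
            (fun δ => Literature.Probability.Percolation.bondInterfaceIn D (E δ))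
            (fun _ => bondPercolation (zdGraph 2) Percolation.half) μ → IsSLELaw 6 D μ) →
    SLESixOnZhouClass → Literature.Probability.Percolation.SLE6LimitZ2AllDiscretisations := by
  intro hG hCN hZ D E hE
  exact convergesInLawToSLE_of_ident D E hE (hCN (cardyFormulaZ2_of_zhouClass hG hZ) D E hE)

end Summit.CriticalPhenomena.CardyFormulaZ2.Theorems.SymmetryUpgradeR.ZhouRotationSplitAudit

end
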